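import Summits.BirchSwinnertonDyer.BirchSwinnertonDyer.Theorems.ByReductionTypeAtTwoMultTowerSplitExactOddUnits
import Literature.NumberTheory.EllipticCurves.PadicSigmaLogFirstOrderProofs
import HarnessLib

/-!
# Route `ByReductionTypeAtTwo`, crux `MultUpperHalfAtTwo` (item stmt-BirchSwinnertonDyer-19922), TOWER road, SPLIT rows:
# the EXACT order of the local tower kernel at a split multiplicative prime, part 8 (ODD `p`) — the `p`-ADIC DEPTH of the
# Tate unit and the Iwasawa logarithm: `ord_p(log_p q) = d`, `‖u^{p−1} − 1‖ = p^{−d}`, `u^{(p−1)p^s a} ≢ 1 (mod p^{d+s+1})`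

HONEST FRAMING (cell `bsd-2adic`, run/shared/lean/pub/bsd-2adic/, seat `bsd-2adic-tower-1` GEN 27, HUMAN RULINGS
D-0036 / D-0054 / D-0074): TOOL theorems only (no definition, no named fact, no `sorry`); closes nothing by itself;
nothing booked; BSD is not proved by any of this. Odd-`p` analogue of seat bsd-2adic-mult GEN 13's
`…MultTowerSplitOrderTwoAdicDepth.lean` (BRICK S1), for the UPPER bound of the `∀ p` named fact
`hSP = Greenberg1999.sec3_natCard_localTowerKerPrimary_splitMultiplicative_rat`:

* `padicLog_pow_eq` — `log_p (y^N) = N · log_p y`; `padicLog_prime_pow_mul` — `log_p (p^k x) = log_p x`;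
* `norm_one_sub_pow_eq` — **`‖1 − y^N‖ = ‖N‖ · ‖1 − y‖` for `‖1 − y‖ < 1`, odd `p`** (the logarithm is an ISOMETRY on
  `1 + pℤ_p` for odd `p`, the tree's `norm_padicLog_eq_norm_one_sub`, and `log y^N = N log y`);
* `toZModPow_eq_one_iff_norm_sub_one_le` — `x ≡ 1 (mod p^n) ↔ ‖x − 1‖ ≤ p^{−n}`;
* `exists_depth_of_padicLog_odd` — **the depth**: for `q = p^k u` (`u ∈ ℤ_pˣ`) with `log_p q ≠ 0` there is `d ≥ 1` with
  `‖1 − u^{p−1}‖ = p^{−d}` and `ord_p(log_p q) = d` (`log_p q = log_p u = (p−1)⁻¹ log_p u^{p−1}`);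
* `toZModPow_pow_pow_ne_one_of_depth` — **`(u^{p^s a})^{p−1} ≢ 1 (mod p^{M+1})`** for `p ∤ a` and `d + s ≤ M`
  (`‖(u^{p−1})^{p^s a} − 1‖ = p^{−(d+s)} > p^{−(M+1)}`).

References: K. Iwasawa, *Lectures on p-adic L-functions* (1972), §4.4; J.-P. Serre, *A Course in Arithmetic*, Ch. II
§3; cell memo NOTE-HNS2-KERNEL-GEN27.md (Stage D plan).
-/

set_option autoImplicit false
-- the Theorems namespace of this sub repeats the summit name by design (D-0017 nested layout: Summit.<S>.<Sub>)
set_option linter.dupNamespace false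

noncomputable section

open scoped Classical

namespace Summit.BirchSwinnertonDyer.BirchSwinnertonDyer.Theorems.MultTowerSplitExact

open PadicInt Literature.NumberTheory.EllipticCurves

variable {p : ℕ} [hp : Fact p.Prime]

/-! ### The Iwasawa logarithm: powers and the isometry on `1 + pℤ_p` -/

/-- `log_p 1 = 0`. [cite: Iwasawa1972PadicL, §4.4] -/
theorem padicLog_one : padicLog p (1 : ℚ_[p]) = 0 := by
  have h := padicLog_mul_holds p (x := 1) (y := 1) one_ne_zero one_ne_zero
  rw [mul_one] at h
  linear_combination -h

/-- **`log_p (y^N) = N · log_p y`** (`y ≠ 0`). [cite: Iwasawa1972PadicL, §4.4] -/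
theorem padicLog_pow_eq {y : ℚ_[p]} (hy : y ≠ 0) (N : ℕ) :
    padicLog p (y ^ N) = (N : ℚ_[p]) * padicLog p y := by
  induction N with
  | zero => rw [pow_zero, padicLog_one, Nat.cast_zero, zero_mul]
  | succ N ih =>
    rw [pow_succ, padicLog_mul_holds p (pow_ne_zero _ hy) hy, ih]
    push_cast
    ring

/-- **`log_p (p^k · x) = log_p x`** (`x ≠ 0`): Iwasawa's normalisation `log_p p = 0`. [cite: Iwasawa1972PadicL, §4.4] -/
theorem padicLog_prime_pow_mul (k : ℕ) {x : ℚ_[p]} (hx : x ≠ 0) :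
    padicLog p ((p : ℚ_[p]) ^ k * x) = padicLog p x := by
  have hp0 : (p : ℚ_[p]) ≠ 0 := by exact_mod_cast hp.out.ne_zero
  have hlp : padicLog p (p : ℚ_[p]) = 0 := padicLog_natCast_self_holds p
  rw [padicLog_mul_holds p (pow_ne_zero _ hp0) hx, padicLog_pow_eq hp0, hlp, mul_zero, zero_add]

/-- **`‖1 − y^N‖ = ‖N‖ · ‖1 − y‖` for `‖1 − y‖ < 1` and odd `p`**: the logarithm is an isometry on the principal
units for odd `p` (`‖log_p y‖ = ‖1 − y‖`), and `log_p y^N = N log_p y`. [cite: Iwasawa1972PadicL, §4.4] -/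
theorem norm_one_sub_pow_eq (hp2 : p ≠ 2) {y : ℚ_[p]} (hy : ‖1 - y‖ < 1) (N : ℕ) :
    ‖1 - y ^ N‖ = ‖(N : ℚ_[p])‖ * ‖1 - y‖ := by
  have hy1 : ‖y‖ = 1 := norm_eq_one_of_norm_one_sub_lt hy
  have hy0 : y ≠ 0 := norm_pos_iff.mp (by rw [hy1]; exact one_pos)
  rw [← norm_padicLog_eq_norm_one_sub hp2 (norm_one_sub_pow_lt hy N), padicLog_pow_eq hy0, norm_mul,
    norm_padicLog_eq_norm_one_sub hp2 hy]

/-! ### Congruences modulo `p^n` and norms -/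

/-- `x ≡ 1 (mod p^n)` in `ℤ_p` iff `‖x − 1‖ ≤ p^{−n}`. [folklore] -/
theorem toZModPow_eq_one_iff_norm_sub_one_le (n : ℕ) (x : ℤ_[p]) :
    toZModPow n x = 1 ↔ ‖x - 1‖ ≤ (p : ℝ) ^ (-(n : ℤ)) := by
  rw [← (toZModPow n).map_one, ← sub_eq_zero, ← map_sub, ← RingHom.mem_ker, ker_toZModPow,
    ← norm_le_pow_iff_mem_span_pow]

/-! ### The depth of the Tate unit -/

/-- **The depth from the Iwasawa logarithm (odd `p`).** For `q = p^k · u` (`u` a unit of `ℤ_p`) with `log_p q ≠ 0` there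
is `d ≥ 1` with `‖1 − u^{p−1}‖ = p^{−d}` and `ord_p(log_p q) = d`: `log_p q = log_p u`, `(p − 1) log_p u = log_p u^{p−1}`
has norm `‖1 − u^{p−1}‖` (isometry on `1 + pℤ_p`), and `‖p − 1‖ = 1`. [cite: Iwasawa1972PadicL, §4.4] -/
theorem exists_depth_of_padicLog_odd (hp2 : p ≠ 2) {q : ℚ_[p]} {k : ℕ} {u : ℤ_[p]ˣ}
    (hq : q = (p : ℚ_[p]) ^ k * ((u : ℤ_[p]) : ℚ_[p])) (hlog : padicLog p q ≠ 0) :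
    ∃ d : ℕ, 1 ≤ d ∧ ‖1 - ((u : ℤ_[p]) : ℚ_[p]) ^ (p - 1)‖ = (p : ℝ) ^ (-(d : ℤ)) ∧
      (padicLog p q).valuation = d := by
  have hu1 : ‖((u : ℤ_[p]) : ℚ_[p])‖ = 1 := PadicInt.norm_units u
  have hu0 : ((u : ℤ_[p]) : ℚ_[p]) ≠ 0 := norm_pos_iff.mp (by rw [hu1]; exact one_pos)
  have hy : ‖1 - ((u : ℤ_[p]) : ℚ_[p]) ^ (p - 1)‖ < 1 := norm_one_sub_pow_sub_one_lt hu1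
  -- `‖log q‖ = ‖1 − u^{p−1}‖`
  have hlogq : padicLog p q = padicLog p ((u : ℤ_[p]) : ℚ_[p]) := by rw [hq, padicLog_prime_pow_mul k hu0]
  have hpm1 : ‖((p - 1 : ℕ) : ℚ_[p])‖ = 1 := by
    rw [Padic.norm_natCast_eq_one_iff]
    exact ((Nat.Prime.coprime_iff_not_dvd hp.out).mpr
      (Nat.not_dvd_of_pos_of_lt (by have := hp.out.two_le; omega) (by have := hp.out.two_le; omega)))
  have hnorm : ‖padicLog p q‖ = ‖1 - ((u : ℤ_[p]) : ℚ_[p]) ^ (p - 1)‖ := by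
    rw [← norm_padicLog_eq_norm_one_sub hp2 hy, padicLog_pow_eq hu0, norm_mul, hpm1, one_mul, hlogq]
  -- `1 − u^{p−1} ≠ 0`, of norm `p^{−d}`, `d ≥ 1`
  set x : ℚ_[p] := 1 - ((u : ℤ_[p]) : ℚ_[p]) ^ (p - 1) with hx
  have hx0 : x ≠ 0 := by
    intro h0
    rw [h0, norm_zero, norm_eq_zero] at hnorm
    exact hlog hnorm
  have hxv : ‖x‖ = (p : ℝ) ^ (-x.valuation) := Padic.norm_eq_zpow_neg_valuation hx0
  have hp1 : (1 : ℝ) < p := by exact_mod_cast hp.out.one_lt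
  have hd1 : 1 ≤ x.valuation := by
    have hlt : (p : ℝ) ^ (-x.valuation) < (p : ℝ) ^ (0 : ℤ) := by rw [← hxv, zpow_zero]; exact hy
    have := (zpow_lt_zpow_iff_right₀ hp1).mp hlt
    omega
  refine ⟨x.valuation.toNat, by omega, ?_, ?_⟩
  · rw [hxv, Int.toNat_of_nonneg (by omega)]
  · rw [Int.toNat_of_nonneg (by omega)]
    exact valuation_eq_of_norm_eq hlog (by rw [hnorm, hxv])

/-- **`(u^{p^s a})^{p−1} ≢ 1 (mod p^{M+1})` for `p ∤ a` and `d + s ≤ M`**, `d` the depth of the unit `u`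
(`‖1 − u^{p−1}‖ = p^{−d}`, odd `p`): `‖(u^{p−1})^{p^s a} − 1‖ = ‖p^s a‖ · p^{−d} = p^{−(d+s)} > p^{−(M+1)}`. The odd-`p` form of
GEN 13's `toZModPow_pow_ne_one_and_ne_neg_one_of_depth`. [cite: Iwasawa1972PadicL, §4.4] [cite: Serre1973, Ch. II §3.2] -/
theorem toZModPow_pow_pow_ne_one_of_depth (hp2 : p ≠ 2) {u : ℤ_[p]ˣ} {d : ℕ}
    (hd : ‖1 - ((u : ℤ_[p]) : ℚ_[p]) ^ (p - 1)‖ = (p : ℝ) ^ (-(d : ℤ))) {a : ℕ} (ha : ¬ p ∣ a) (s : ℕ) {M : ℕ}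
    (hM : d + s ≤ M) :
    toZModPow (M + 1) ((((u : ℤ_[p])) ^ (p ^ s * a)) ^ (p - 1)) ≠ 1 := by
  intro h1
  rw [toZModPow_eq_one_iff_norm_sub_one_le] at h1
  have hp0 : (0 : ℝ) < p := by exact_mod_cast hp.out.pos
  have hp1 : (1 : ℝ) < p := by exact_mod_cast hp.out.one_lt
  -- `‖(u^{p^s a})^{p-1} − 1‖ = p^{−(d+s)}`
  have hy : ‖1 - ((u : ℤ_[p]) : ℚ_[p]) ^ (p - 1)‖ < 1 := norm_one_sub_pow_sub_one_lt (PadicInt.norm_units u)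
  have hN : ‖((p ^ s * a : ℕ) : ℚ_[p])‖ = (p : ℝ) ^ (-(s : ℤ)) := by
    have ha1 : ‖(a : ℚ_[p])‖ = 1 := by
      rw [Padic.norm_natCast_eq_one_iff]
      exact (Nat.Prime.coprime_iff_not_dvd hp.out).mpr ha
    rw [Nat.cast_mul, Nat.cast_pow, norm_mul, ha1, mul_one, Padic.norm_p_pow]
  have hnorm : ‖(((u : ℤ_[p])) ^ (p ^ s * a)) ^ (p - 1) - 1‖ = (p : ℝ) ^ (-((d : ℤ) + s)) := by
    rw [PadicInt.norm_def, PadicInt.coe_sub, PadicInt.coe_pow, PadicInt.coe_pow, PadicInt.coe_one, ← pow_mul,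
      mul_comm (p ^ s * a) (p - 1), pow_mul, norm_sub_rev, norm_one_sub_pow_eq hp2 hy, hN, hd, ← zpow_add₀ hp0.ne']
    congr 1; ring
  rw [hnorm] at h1
  have := (zpow_le_zpow_iff_right₀ hp1).mp h1
  omega

end Summit.BirchSwinnertonDyer.BirchSwinnertonDyer.Theorems.MultTowerSplitExact

end
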